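import Summits.Langlands.Langlands.Theses.SmithKummerSeed
import Summits.Langlands.Langlands.Theorems.IrreducibilityBySelfDualityReciprocityUpToIrreducibilityCorrespondsConj
import Summits.Langlands.Langlands.Theorems.SmithKummerSeedAscentConjugationSolvableSplit
import HarnessLib

/-!
# Glue for the crux chain of `AscentConjugationSolvable` (stmt-Langlands-1094): the two pieces from their registered
# stubs, the crux from the four stubs, and the closable shadow — BUILDABLE edition

Support file (closes nothing).  This file re-lands, in one importable module, the glue of
`SmithKummerSeedCyclicPrimeDescentOfStubs.lean` (p161600) and of the never-applied `…CyclicPrimeAscentOfStubs.lean`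
(p162569): p161600 imported the route file `Theses/LiftDescend.lean` (to prove item stmt-Langlands-1065 by name), and that
route file — like `Theses/BaseFieldAscent.lean` — no longer elaborates against the summit re-typed on 2026-08-16
(`Nonempty (ReciprocityData F) ∧ ∀ 𝓡 …`; lead memo LEAD-c2-report.md), so the farm cannot build p161600's module
(`no-olean`) nor anything importing it.  Here only `Theses/SmithKummerSeed.lean` (rev 7, repaired) is imported; the
declarations live in the fresh namespace `…Theorems.SmithKummerSeedCyclicPrimeGlue`.

Contents (all kernel-checked compositions over the strategist's registered stub signatures, VERBATIM as hypotheses):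
* `galoisToAutomorphic_of_weak_rank` — weak (B) in one rank + (A) in every rank ⇒ (B) in that rank, for one datum
  (Chebotarev–Brauer–Nesbitt transport `ReciprocityUpToIrreducibility.corresponds_of_exists_corresponds`);
  (`cyclicPrimeDescent_of_stubs` — `CyclicPrimeDescent` ⇐ its two stubs — stays in p161600's module and is inlined below);
* `cyclicPrimeAscent_of_stubs` — `CyclicPrimeAscent` (stmt-Langlands-18649) ⇐ `stub_ascentAutToGal ∧ stub_ascentWeakGalToAut`;
* `ascentConjugationSolvable_of_fourStubs` — the crux (the `SmithKummerSeed` spelling of the shared decl) from the four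
  stubs, through the landed `AscentConjugationSolvableSplit.ascentConjugationSolvable_of_pieces` (p147205);
* `recip_of_cyclicallyTowered` — the closable shadow: the UP-step alone gives reciprocity over every field cyclically
  towered over TR ∪ CM (typed impredicatively; the conjugation-solvable fields outside that class, e.g. `ℚ(∛2)`, are
  where the descent atom `Cruxes/AscentConjugationSolvable/Atom.lean` lives).

No `sorry`, no new definition, no named-fact hypothesis; standard axioms.

References: Arthur–Clozel, Ann. of Math. Stud. 120 (1989), Ch. 3 Thms. 4.2, 6.2; Deligne–Serre, ASENS 7 (1974), Lemme 3.2;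
Buzzard–Gee, LMS LNS 414 (2014), Conj. 3.2.2.
-/

noncomputable section

set_option linter.dupNamespace false -- project-wide option; `Summit.Langlands.Langlands` is the mandated namespace

namespace Summit.Langlands.Langlands.Theorems.SmithKummerSeedCyclicPrimeGlue

open Summit.Langlands Summit.Langlands.Langlands.Theses.SmithKummerSeed
open Filter

/-- **Weak-to-strong upgrade of direction (B) in ONE rank, for the same reciprocity data**: (A) for `R` in every
rank + a.e. Satake matching of every irreducible `R`-geometric `ρ` of rank `n` ⇒ `GaloisToAutomorphic n R hcpt`, by the
landed Chebotarev–Brauer–Nesbitt transport `corresponds_of_exists_corresponds`.  (Rank-local form of the body of item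
stmt-Langlands-1065 `LiftDescend.WeakToStrongGalToAut`, whose all-rank form is landed in the currently unbuildable
module `SmithKummerSeedCyclicPrimeDescentOfStubs`.) [cite: DeligneSerreASENS1974, Lemme 3.2] -/
theorem galoisToAutomorphic_of_weak_rank {F : Type} [Field F] [NumberField F] (R : ReciprocityData F)
    (hA : ∀ n : ℕ, 0 < n →
      ∀ hcpt : Literature.NumberTheory.Automorphic.isCompact_glFiniteIntegralLevel n F,
        AutomorphicToGalois n R hcpt)
    {n : ℕ} (hn : 0 < n) (hcpt : Literature.NumberTheory.Automorphic.isCompact_glFiniteIntegralLevel n F)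
    (hW : ∀ (ℓ : ℕ) [Fact ℓ.Prime] (ι : PadicAlgCl ℓ ≃+* ℂ)
      (ρ : Literature.NumberTheory.GaloisRepresentations.FramedGaloisRep F (PadicAlgCl ℓ) n),
      ρ.toGaloisRep.IsIrreducible → IsGeometricFramed R ρ →
        ∃ π : Literature.NumberTheory.Automorphic.CuspidalAutomorphicRepData n F hcpt,
          π.1.IsLAlgebraic ∧
            ∀ᶠ v : IsDedekindDomain.HeightOneSpectrum (NumberField.RingOfIntegers F) in cofinite,
              SatakeFrobCompatibleAt ι π.1 ρ v) :
    GaloisToAutomorphic n R hcpt := by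
  intro ℓ _ ι ρ hirr hgeo
  obtain ⟨π, hL, hsat⟩ := hW ℓ ι ρ hirr hgeo
  obtain ⟨ρ', -, -, hcorr', -⟩ := hA n hn hcpt π hL ℓ ι
  exact ⟨π, hL,
    Theorems.ReciprocityUpToIrreducibility.corresponds_of_exists_corresponds hirr hsat ⟨ρ', hcorr'⟩⟩

/-- **`CyclicPrimeAscent` (stmt-Langlands-18649) from its two registered stubs, BY NAME** (signatures verbatim).
[folklore] -/
theorem cyclicPrimeAscent_of_stubs : (∀ (K L : Type) [Field K] [NumberField K] [Field L] [NumberField L] [Algebra K L] [IsGalois K L], (Module.finrank K L).Prime → (∃ R : ReciprocityData K, ∀ n : ℕ, 0 < n → ∀ hcpt : Literature.NumberTheory.Automorphic.isCompact_glFiniteIntegralLevel n K, GlobalLanglandsCorrespondenceGLn n K R hcpt) → ∃ R : ReciprocityData L, ∀ n : ℕ, 0 < n → ∀ hcpt : Literature.NumberTheory.Automorphic.isCompact_glFiniteIntegralLevel n L, AutomorphicToGalois n R hcpt) → (∀ (K L : Type) [Field K] [NumberField K] [Field L] [NumberField L] [Algebra K L] [IsGalois K L] (R : ReciprocityData L),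 (Module.finrank K L).Prime → (∃ R₀ : ReciprocityData K, ∀ n : ℕ, 0 < n → ∀ hcpt : Literature.NumberTheory.Automorphic.isCompact_glFiniteIntegralLevel n K, GlobalLanglandsCorrespondenceGLn n K R₀ hcpt) → (∀ n : ℕ, 0 < n → ∀ hcpt : Literature.NumberTheory.Automorphic.isCompact_glFiniteIntegralLevel n L, AutomorphicToGalois n R hcpt) → ∀ (n : ℕ), 0 < n → ∀ (ℓ : ℕ) [Fact ℓ.Prime] (ι : PadicAlgCl ℓ ≃+* ℂ) (ρ : Literature.NumberTheory.GaloisRepresentations.FramedGaloisRep L (PadicAlgCl ℓ) n), ρ.toGaloisRep.IsIrreducible → IsGeometricFramed R ρ → ∀ hcpt : Literature.NumberTheory.Automorphic.isCompact_glFiniteIntegralLevel n L, ∃ π : Literature.NumberTheory.Automorphic.CuspidalAutomorphicRepData n L hcpt, π.1.IsLAlgebraic ∧ ∀ᶠ v : IsDedekindDomain.HeightOneSpectrum (NumberField.RingOfIntegers L) in cofinite, SatakeFrobCompatibleAt ι π.1 ρ v) → Summit.Langlands.Langlands.Theses.SmithKummerSeed.CyclicPrimeAscent := by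
  intro h₁ h₂ K L _ _ _ _ _ _ hp hK
  obtain ⟨R, hAR⟩ := h₁ K L hp hK
  exact ⟨R, fun n hn hcpt => ⟨hAR n hn hcpt,
    galoisToAutomorphic_of_weak_rank R hAR hn hcpt fun ℓ _ ι ρ hi hg => h₂ K L R hp hK hAR n hn ℓ ι ρ hi hg hcpt⟩⟩

/-- **The crux `AscentConjugationSolvable` (stmt-Langlands-1094; `SmithKummerSeed` spelling of the shared decl) from
the FOUR registered child stubs, BY NAME**, through `cyclicPrimeAscent_of_stubs`, the inlined descent composition and the landed
`AscentConjugationSolvableSplit.ascentConjugationSolvable_of_pieces` (p147205). [folklore] -/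
theorem ascentConjugationSolvable_of_fourStubs : (∀ (K L : Type) [Field K] [NumberField K] [Field L] [NumberField L] [Algebra K L] [IsGalois K L], (Module.finrank K L).Prime → (∃ R : ReciprocityData K, ∀ n : ℕ, 0 < n → ∀ hcpt : Literature.NumberTheory.Automorphic.isCompact_glFiniteIntegralLevel n K, GlobalLanglandsCorrespondenceGLn n K R hcpt) → ∃ R : ReciprocityData L, ∀ n : ℕ, 0 < n → ∀ hcpt : Literature.NumberTheory.Automorphic.isCompact_glFiniteIntegralLevel n L, AutomorphicToGalois n R hcpt) → (∀ (K L : Type) [Field K] [NumberField K] [Field L] [NumberField L] [Algebra K L] [IsGalois K L] (R : ReciprocityData L), (Module.finrank K L).Prime → (∃ R₀ : ReciprocityData K, ∀ n : ℕ, 0 < n → ∀ hcpt : Literature.NumberTheory.Automorphic.isCompact_glFiniteIntegralLevel n K, GlobalLanglandsCorrespondenceGLn n K R₀ hcpt) → (∀ n : ℕ, 0 < n → ∀ hcpt : Literature.NumberTheory.Automorphic.isCompact_glFiniteIntegralLevel n L, AutomorphicToGalois n R hcpt) → ∀ (n : ℕ), 0 < n → ∀ (ℓ : ℕ) [Fact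 ℓ.Prime] (ι : PadicAlgCl ℓ ≃+* ℂ) (ρ : Literature.NumberTheory.GaloisRepresentations.FramedGaloisRep L (PadicAlgCl ℓ) n), ρ.toGaloisRep.IsIrreducible → IsGeometricFramed R ρ → ∀ hcpt : Literature.NumberTheory.Automorphic.isCompact_glFiniteIntegralLevel n L, ∃ π : Literature.NumberTheory.Automorphic.CuspidalAutomorphicRepData n L hcpt, π.1.IsLAlgebraic ∧ ∀ᶠ v : IsDedekindDomain.HeightOneSpectrum (NumberField.RingOfIntegers L) in cofinite, SatakeFrobCompatibleAt ι π.1 ρ v) → (∀ (K L : Type) [Field K] [NumberField K] [Field L] [NumberField L] [Algebra K L] [IsGalois K L], (Module.finrank K L).Prime → (∃ R : ReciprocityData L, ∀ n : ℕ, 0 < n → ∀ hcpt : Literature.NumberTheory.Automorphic.isCompact_glFiniteIntegralLevel n L, GlobalLanglandsCorrespondenceGLn n L R hcpt) → ∃ R : ReciprocityData K, ∀ n : ℕ, 0 < n → ∀ hcpt : Literature.NumberTheory.Automorphic.isCompact_glFiniteIntegralLevel n K, AutomorphicToGalois n R hcpt) → (∀ (K L : Type) [Field K] [NumberField K] [Field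 L] [NumberField L] [Algebra K L] [IsGalois K L] (R : ReciprocityData K), (Module.finrank K L).Prime → (∃ R₁ : ReciprocityData L, ∀ n : ℕ, 0 < n → ∀ hcpt : Literature.NumberTheory.Automorphic.isCompact_glFiniteIntegralLevel n L, GlobalLanglandsCorrespondenceGLn n L R₁ hcpt) → (∀ n : ℕ, 0 < n → ∀ hcpt : Literature.NumberTheory.Automorphic.isCompact_glFiniteIntegralLevel n K, AutomorphicToGalois n R hcpt) → ∀ (n : ℕ), 0 < n → ∀ (ℓ : ℕ) [Fact ℓ.Prime] (ι : PadicAlgCl ℓ ≃+* ℂ) (ρ : Literature.NumberTheory.GaloisRepresentations.FramedGaloisRep K (PadicAlgCl ℓ) n), ρ.toGaloisRep.IsIrreducible → IsGeometricFramed R ρ → ∀ hcpt : Literature.NumberTheory.Automorphic.isCompact_glFiniteIntegralLevel n K, ∃ π : Literature.NumberTheory.Automorphic.CuspidalAutomorphicRepData n K hcpt, π.1.IsLAlgebraic ∧ ∀ᶠ v : IsDedekindDomain.HeightOneSpectrum (NumberField.RingOfIntegers K) in cofinite, SatakeFrobCompatibleAt ι π.1 ρ v) → Summit.Langlands.Langlands.Theses.SmithKummerSeed.AscentConjugationSolvable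 :=
  fun hA₁ hA₂ hD₁ hD₂ =>
    AscentConjugationSolvableSplit.ascentConjugationSolvable_of_pieces (cyclicPrimeAscent_of_stubs hA₁ hA₂)
      fun K L _ _ _ _ _ _ hp hL => by
        -- the descent piece from its two stubs (= `SmithKummerSeedCyclicPrimeDescent.cyclicPrimeDescent_of_stubs`,
        -- p161600, inlined: that module is unbuildable on the farm until `Theses/LiftDescend.lean` is re-rendered)
        obtain ⟨R, hAR⟩ := hD₁ K L hp hL
        exact ⟨R, fun n hn hcpt => ⟨hAR n hn hcpt,
          galoisToAutomorphic_of_weak_rank R hAR hn hcpt fun ℓ _ ι ρ hi hg =>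
            hD₂ K L R hp hL hAR n hn ℓ ι ρ hi hg hcpt⟩⟩

/-- **The closable shadow of the crux: reciprocity over every CYCLICALLY TOWERED field needs the UP-step only.**
If reciprocity ascends along every Galois layer of prime degree (`CyclicPrimeAscent`) and holds over every totally
real or CM field, then it holds over every number field in the least class containing those and closed under Galois
extensions of prime degree (impredicative typing; no descent, no inert-place atom). [folklore] -/
theorem recip_of_cyclicallyTowered : Summit.Langlands.Langlands.Theses.SmithKummerSeed.CyclicPrimeAscent → (∀ (F : Type) [Field F] [NumberField F], (NumberField.IsTotallyReal F ∨ NumberField.IsCMField F) → ∃ R : ReciprocityData F, ∀ n : ℕ, 0 < n → ∀ hcpt : Literature.NumberTheory.Automorphic.isCompact_glFiniteIntegralLevel n F, GlobalLanglandsCorrespondenceGLn n F R hcpt) → ∀ (F : Type) [Field F] [NumberField F], (∀ P : (K : Type) → [Field K] → [NumberField K] → Prop, (∀ (K : Type) [Field K] [NumberField K], (NumberField.IsTotallyReal K ∨ NumberField.IsCMField K) → P K) → (∀ (K L : Type) [Field K] [NumberField K] [Field L] [NumberField L] [Algebra K L] [IsGalois K L], (Module.finrank K L).Prime → P K → P L)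 → P F) → ∃ R : ReciprocityData F, ∀ n : ℕ, 0 < n → ∀ hcpt : Literature.NumberTheory.Automorphic.isCompact_glFiniteIntegralLevel n F, GlobalLanglandsCorrespondenceGLn n F R hcpt :=
  fun hUp hTRCM _ _ _ hTow =>
    hTow (fun (K : Type) [Field K] [NumberField K] => ∃ R : ReciprocityData K, ∀ n : ℕ, 0 < n → ∀ hcpt : Literature.NumberTheory.Automorphic.isCompact_glFiniteIntegralLevel n K, GlobalLanglandsCorrespondenceGLn n K R hcpt)
      (fun K _ _ hK => hTRCM K hK) (fun K L _ _ _ _ _ _ hp hPK => hUp K L hp hPK)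

end Summit.Langlands.Langlands.Theorems.SmithKummerSeedCyclicPrimeGlue

end
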